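import Summits.QuantumAdvantage.QuantumAdvantage.Theses.HiddenSpread

/-!
# Crux `HiddenSpread.HiddenSpreadWitness` (stmt-QuantumAdvantage-2453) — the real/ideal split

Crux-strategist file (route `HiddenSpread`, deciding crux `HiddenSpreadWitness` = thesis X, a
hypothesis-type "classically hard / quantumly easy" assumption that implies the summit through the
route's proved `closes`). The route re-audit bins X as RESTATED (at least summit strength); this file
proves the SUFFICIENCY OF A TYPED DECOMPOSITION of X along the real/ideal seam of Aaronson–Chen 2017
(Thm 7.6: the IDEAL-world separation is a statistical query bound; §8/Thm 8.1: the REAL world needs one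
unrelativised "no more leakage than oracle access" ingredient):

* `SpreadIdealQueryBound` (black-box, theorem-type; the distributional form of the route's evidence crux
  `SpreadShiftQueryLB`): for IDEAL twisted-spread pairs — `b` ranging over all balanced `b : 𝔽_{2^m} → 𝔽₂`
  with `b 0 = 0`, `e` over all `𝔽₂`-linear equivalences `𝔽_{2^m}² ≃ 𝔽₂^{2m}`, `g` the Walsh dual, counted
  with multiplicity — the acceptance frequency of ANY deterministic decision tree of depth `≤ q` on the
  table of `(f, g ⊕ ⟨t,·⟩)` differs between the mask classes `t = 0` and `t ≠ 0` by at most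
  `c (q+1)² / √2^m`. A pure query-complexity statement: it implies nothing about `BPP`.
* `CertifiedSpreadLeakage` (white-box, hypothesis-type): a certified hidden-spread generator — the SAME
  `S ∈ P`, `π ∈ FP`, `dec` structure clause as X, ensembles `D₀` (mask `0`) / `D₁` (mask `≠ 0`) on `S`
  with field degree `mdeg n ≥ n` at level `n` — whose WHITE-BOX distinguishing advantage, for every
  probabilistic polynomial-time `A`, exceeds every uniform bound `δ` on the IDEAL black-box advantage of
  depth-`q_A(n)` trees (`q_A` polynomially bounded) by at most a negligible `ε_A(n)`. It says the
  certified, obfuscated encoding leaks no more about the mask than polynomially many ideal oracle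
  queries do; where twisted spreads are black-box EASY it holds vacuously, so by itself it does not give
  `BQP ⊄ BPP` either.

`HiddenSpreadWitness_of_subs : SpreadIdealQueryBound → CertifiedSpreadLeakage → HiddenSpreadWitness`
(hypotheses spelled VERBATIM as the two sub-crux statements filed on the route, so that the split's glue
is this theorem by name). Proof: keep `S, π, dec, D₀, D₁`; for a PPT `A` take `q, k, ε` from the leakage
hypothesis and feed it, at level `n`, the ideal bound `δ = c (q n + 1)² / √2^{mdeg n}` (field degree
`mdeg n ≥ 2` because `D₀ n` has a point in `S`); then `|Pr[A(D₀ n)] − Pr[A(D₁ n)]| ≤ c (nᵏ+k+1)² (1/√2)ⁿ + ε n`,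
and a polynomial times a geometric sequence plus a negligible function is negligible
(`Asymptotics.SuperpolynomialDecay.polynomial_mul`, `tendsto_pow_const_mul_const_pow_of_abs_lt_one`).
(planner-cstrat-stmt-QuantumAdvantage-2453-r1-0, 2026-08-17.)
-/

set_option linter.dupNamespace false -- D-0017: single-problem summit ⇒ `QuantumAdvantage.QuantumAdvantage` by design

noncomputable section

namespace Summit.QuantumAdvantage.QuantumAdvantage.Theorems.HiddenSpreadWitness.Split

open Filter Asymptotics
open Summit.QuantumAdvantage.QuantumAdvantage.Theses.HiddenSpread (HiddenSpreadWitness)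

/-- A geometric sequence of ratio `1/√2` decays faster than any polynomial in `n`. [folklore] -/
theorem superpolynomialDecay_inv_sqrt_two_pow :
    SuperpolynomialDecay atTop (fun n : ℕ => (n : ℝ)) (fun n : ℕ => (Real.sqrt 2)⁻¹ ^ n) := by
  intro p
  have h : |(Real.sqrt 2)⁻¹| < 1 := by
    rw [abs_of_pos (inv_pos.2 (zero_lt_one.trans Real.one_lt_sqrt_two))]
    exact inv_lt_one_of_one_lt₀ Real.one_lt_sqrt_two
  simpa using tendsto_pow_const_mul_const_pow_of_abs_lt_one p h

/-- **Sufficiency of the real/ideal split.** Ideal black-box query bound for twisted-spread mask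
classes ∧ a certified generator leaking no more than polynomially many ideal queries ⟹ the crux
`HiddenSpreadWitness`. The two hypotheses are, verbatim, the sub-crux statements
`SpreadIdealQueryBound` and `CertifiedSpreadLeakage` filed on route `HiddenSpread`.
[cite: AaronsonChen2017, Thm 7.6 and §8] [cite: Roetteler2010, Def 2, Thm 6] -/
theorem HiddenSpreadWitness_of_subs
    (hstat : ∃ c : ℝ, 0 < c ∧ ∀ m : ℕ, 2 ≤ m → ∀ (ι : Bool × (Fin (2 * m) → Bool) ≃ Fin (2 * 2 ^ (2 * m))) (T : Literature.Computability.Complexity.DecisionTree (2 * 2 ^ (2 * m))) (q : ℕ), T.depth ≤ q → (let wt : ((Fin (2 * m) → Bool) → Prop) → (Fin (2 * 2 ^ (2 * m)) → Bool) → ℝ := fun (M : (Fin (2 * m) → Bool) → Prop) (tbl : Fin (2 * 2 ^ (2 * m)) → Bool) => (Nat.card {σ : (GaloisField 2 m → Bool) × ((GaloisField 2 m × GaloisField 2 m) ≃ₗ[ZMod 2] (Fin (2 * m) → ZMod 2)) × ((Fin (2 * m) → Bool) → Bool) × (Fin (2 * m) → Bool) // ((Nat.card {a : GaloisField 2 m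 // σ.1 a = true} = 2 ^ (m - 1) ∧ σ.1 0 = false) ∧ (∀ u : Fin (2 * m) → Bool, ∑ w : Fin (2 * m) → Bool, Literature.Computability.QuantumComplexity.signOf ((fun w : Fin (2 * m) → Bool => σ.1 ((σ.2.1.symm (fun i => if w i then (1 : ZMod 2) else 0)).1 * (σ.2.1.symm (fun i => if w i then (1 : ZMod 2) else 0)).2 ^ (2 ^ m - 2))) w) * Literature.Computability.QuantumComplexity.twist u w = (2 : ℝ) ^ m * Literature.Computability.QuantumComplexity.signOf (σ.2.2.1 u))) ∧ M σ.2.2.2 ∧ tbl = (fun k : Fin (2 * 2 ^ (2 * m)) => if (ι.symm k).1 then xor (σ.2.2.1 (ι.symm k).2) (Nat.bodd (Finset.univ.filter fun i => σ.2.2.2 i && (ι.symm k).2 i).card) else σ.1 ((σ.2.1.symm (fun i => if (ι.symm k).2 i then (1 : ZMod 2) else 0)).1 * (σ.2.1.symm (fun i => if (ι.symm k).2 i then (1 : ZMod 2) else 0)).2 ^ (2 ^ m - 2)))} : ℝ); let acc : ((Fin (2 * m) → Bool) → Prop) → ℝ := fun (M : (Fin (2 * m) → Bool) → Prop) => (∑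 tbl : Fin (2 * 2 ^ (2 * m)) → Bool, wt M tbl * (if T.eval tbl = true then (1 : ℝ) else 0)) / (∑ tbl : Fin (2 * 2 ^ (2 * m)) → Bool, wt M tbl); |acc (fun t => t = fun _ => false) - acc (fun t => t ≠ fun _ => false)| ≤ c * ((q : ℝ) + 1) ^ 2 / Real.sqrt 2 ^ m))
    (hleak : ∃ S : Set (List Bool), S ∈ Literature.Computability.Complexity.Classes.P ∧ ∃ π : List Bool → List Bool, π ∈ Literature.Computability.Complexity.FP ∧ ∃ dec : List Bool → Σ m : ℕ, (Fin 2 → Literature.Computability.Complexity.Circuit (Fin (2 * m))) × (Fin (2 * m) → Bool), (∀ x ∈ S, 2 ≤ (dec x).1 ∧ (∀ i, ((dec x).2.1 i).IsOver Literature.Computability.Complexity.B2) ∧ π x = (⟨2 * (dec x).1, 2, (dec x).2.1⟩ : Literature.Computability.QuantumComplexity.KForrelationInstance).encode ∧ (let m := (dec x).1; (∃ (b : GaloisField 2 m → Bool) (e : (GaloisField 2 m × GaloisField 2 m) ≃ₗ[ZMod 2] (Fin (2 * m) → ZMod 2)) (g : (Fin (2 * m) → Bool) → Bool), (Nat.card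 {a : GaloisField 2 m // b a = true} = 2 ^ (m - 1) ∧ b 0 = false) ∧ (∀ u : Fin (2 * m) → Bool, ∑ w : Fin (2 * m) → Bool, Literature.Computability.QuantumComplexity.signOf ((fun w : Fin (2 * m) → Bool => b ((e.symm (fun i => if w i then (1 : ZMod 2) else 0)).1 * (e.symm (fun i => if w i then (1 : ZMod 2) else 0)).2 ^ (2 ^ m - 2))) w) * Literature.Computability.QuantumComplexity.twist u w = (2 : ℝ) ^ m * Literature.Computability.QuantumComplexity.signOf (g u)) ∧ ((dec x).2.1 0).eval = (fun w : Fin (2 * m) → Bool => b ((e.symm (fun i => if w i then (1 : ZMod 2) else 0)).1 * (e.symm (fun i => if w i then (1 : ZMod 2) else 0)).2 ^ (2 ^ m - 2))) ∧ ((dec x).2.1 1).eval = (fun u : Fin (2 * m) → Bool => xor (g u) (Nat.bodd (Finset.univ.filter fun i => (dec x).2.2 i && u i).card))))) ∧ ∃ (mdeg : ℕ → ℕ) (D₀ D₁ : ℕ → PMF (List Bool)), (∀ n, n ≤ mdeg n) ∧ (∀ n, ∀ x ∈ (D₀ n).support, x ∈ S ∧ (dec x).2.2 = (fun _ => false) ∧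 (dec x).1 = mdeg n) ∧ (∀ n, ∀ x ∈ (D₁ n).support, x ∈ S ∧ (dec x).2.2 ≠ (fun _ => false) ∧ (dec x).1 = mdeg n) ∧ ∀ A : Literature.Computability.Complexity.RandAlg (List Bool) Bool, A.IsPolyTime id Computability.encodeBool → ∃ (q : ℕ → ℕ) (k : ℕ) (ε : ℕ → ℝ), (∀ n, q n ≤ n ^ k + k) ∧ Asymptotics.SuperpolynomialDecay Filter.atTop (fun n : ℕ => (n : ℝ)) ε ∧ ∀ (n : ℕ) (δ : ℝ), (∀ (ι : Bool × (Fin (2 * (mdeg n)) → Bool) ≃ Fin (2 * 2 ^ (2 * (mdeg n)))) (T : Literature.Computability.Complexity.DecisionTree (2 * 2 ^ (2 * (mdeg n)))), T.depth ≤ q n → (let wt : ((Fin (2 * (mdeg n)) → Bool) → Prop) → (Fin (2 * 2 ^ (2 * (mdeg n))) → Bool) → ℝ := fun (M : (Fin (2 * (mdeg n)) → Bool) → Prop) (tbl : Fin (2 * 2 ^ (2 * (mdeg n))) → Bool) => (Nat.card {σ : (GaloisField 2 (mdeg n) → Bool) × ((GaloisField 2 (mdeg n) × GaloisField 2 (mdeg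 n)) ≃ₗ[ZMod 2] (Fin (2 * (mdeg n)) → ZMod 2)) × ((Fin (2 * (mdeg n)) → Bool) → Bool) × (Fin (2 * (mdeg n)) → Bool) // ((Nat.card {a : GaloisField 2 (mdeg n) // σ.1 a = true} = 2 ^ ((mdeg n) - 1) ∧ σ.1 0 = false) ∧ (∀ u : Fin (2 * (mdeg n)) → Bool, ∑ w : Fin (2 * (mdeg n)) → Bool, Literature.Computability.QuantumComplexity.signOf ((fun w : Fin (2 * (mdeg n)) → Bool => σ.1 ((σ.2.1.symm (fun i => if w i then (1 : ZMod 2) else 0)).1 * (σ.2.1.symm (fun i => if w i then (1 : ZMod 2) else 0)).2 ^ (2 ^ (mdeg n) - 2))) w) * Literature.Computability.QuantumComplexity.twist u w = (2 : ℝ) ^ (mdeg n) * Literature.Computability.QuantumComplexity.signOf (σ.2.2.1 u))) ∧ M σ.2.2.2 ∧ tbl = (fun k : Fin (2 * 2 ^ (2 * (mdeg n))) => if (ι.symm k).1 then xor (σ.2.2.1 (ι.symm k).2) (Nat.bodd (Finset.univ.filter fun i => σ.2.2.2 i && (ι.symm k).2 i).card) else σ.1 ((σ.2.1.symm (fun i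 => if (ι.symm k).2 i then (1 : ZMod 2) else 0)).1 * (σ.2.1.symm (fun i => if (ι.symm k).2 i then (1 : ZMod 2) else 0)).2 ^ (2 ^ (mdeg n) - 2)))} : ℝ); let acc : ((Fin (2 * (mdeg n)) → Bool) → Prop) → ℝ := fun (M : (Fin (2 * (mdeg n)) → Bool) → Prop) => (∑ tbl : Fin (2 * 2 ^ (2 * (mdeg n))) → Bool, wt M tbl * (if T.eval tbl = true then (1 : ℝ) else 0)) / (∑ tbl : Fin (2 * 2 ^ (2 * (mdeg n))) → Bool, wt M tbl); |acc (fun t => t = fun _ => false) - acc (fun t => t ≠ fun _ => false)| ≤ δ)) → |(((D₀ n).bind fun s => A.outputPMF id (Literature.Computability.Complexity.boolPair (Computability.unaryEncodeNat n) s)) true).toReal - (((D₁ n).bind fun s => A.outputPMF id (Literature.Computability.Complexity.boolPair (Computability.unaryEncodeNat n) s)) true).toReal| ≤ δ + ε n) :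
    HiddenSpreadWitness := by
  classical
  obtain ⟨c, hc, hbound⟩ := hstat
  obtain ⟨S, hS, π, hπ, dec, hstruct, mdeg, D₀, D₁, hmn, hD₀, hD₁, hleak⟩ := hleak
  refine ⟨S, hS, π, hπ, dec, hstruct, D₀, D₁, ?_, fun n x hx => ⟨(hD₀ n x hx).1, (hD₀ n x hx).2.1⟩,
    fun n x hx => ⟨(hD₁ n x hx).1, (hD₁ n x hx).2.1⟩⟩
  intro A hA
  obtain ⟨q, k, ε, hq, hε, hclose⟩ := hleak A hA
  -- every level carries a certified point, hence field degree `≥ 2`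
  have hm2 : ∀ n, 2 ≤ mdeg n := fun n => by
    obtain ⟨x, hx⟩ := (D₀ n).support_nonempty
    obtain ⟨hxS, -, hxm⟩ := hD₀ n x hx
    exact (hstruct x hxS).1.trans_eq hxm
  -- the comparison sequence: a polynomial times `(1/√2)ⁿ`, plus `ε`
  set r : ℝ := (Real.sqrt 2)⁻¹ with hr
  have hr0 : 0 < r := inv_pos.2 (zero_lt_one.trans Real.one_lt_sqrt_two)
  let P : Polynomial ℝ :=
    Polynomial.C c * (Polynomial.X ^ k + Polynomial.C (k : ℝ) + 1) ^ 2
  have hP : ∀ n : ℕ, P.eval (n : ℝ) = c * ((n : ℝ) ^ k + k + 1) ^ 2 := fun n => by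
    simp only [P, Polynomial.eval_mul, Polynomial.eval_pow, Polynomial.eval_add, Polynomial.eval_C,
      Polynomial.eval_X, Polynomial.eval_one]
  have hg : SuperpolynomialDecay atTop (fun n : ℕ => (n : ℝ))
      (fun n : ℕ => c * ((n : ℝ) ^ k + k + 1) ^ 2 * r ^ n + ε n) := by
    refine SuperpolynomialDecay.add ?_ hε
    refine (superpolynomialDecay_inv_sqrt_two_pow.polynomial_mul P).congr fun n => ?_
    rw [hP, hr]
  refine hg.trans_abs_le fun n => ?_
  -- the white-box advantage at level `n`, fed with the ideal bound at depth `q n`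
  have h1 := hclose n (c * ((q n : ℝ) + 1) ^ 2 / Real.sqrt 2 ^ (mdeg n))
    (fun ι T hT => hbound (mdeg n) (hm2 n) ι T (q n) hT)
  have h2 : c * ((q n : ℝ) + 1) ^ 2 / Real.sqrt 2 ^ (mdeg n) ≤
      c * ((n : ℝ) ^ k + k + 1) ^ 2 * r ^ n := by
    have hsq : (1 : ℝ) ≤ Real.sqrt 2 := Real.one_lt_sqrt_two.le
    have hqn : (q n : ℝ) + 1 ≤ (n : ℝ) ^ k + k + 1 := by
      have : (q n : ℝ) ≤ (n : ℝ) ^ k + k := by exact_mod_cast hq n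
      linarith
    have hpow : Real.sqrt 2 ^ n ≤ Real.sqrt 2 ^ (mdeg n) := pow_le_pow_right₀ hsq (hmn n)
    have hpos : 0 < Real.sqrt 2 ^ n := pow_pos (zero_lt_one.trans_le hsq) n
    have hinv : (Real.sqrt 2 ^ (mdeg n))⁻¹ ≤ r ^ n := by
      rw [hr, inv_pow]
      exact inv_anti₀ hpos hpow
    have hq0 : (0 : ℝ) ≤ (q n : ℝ) + 1 := by positivity
    calc c * ((q n : ℝ) + 1) ^ 2 / Real.sqrt 2 ^ (mdeg n)
        = c * ((q n : ℝ) + 1) ^ 2 * (Real.sqrt 2 ^ (mdeg n))⁻¹ := div_eq_mul_inv _ _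
      _ ≤ c * ((n : ℝ) ^ k + k + 1) ^ 2 * r ^ n := by
          gcongr
  rw [abs_abs]
  exact h1.trans ((add_le_add h2 le_rfl).trans (le_abs_self _))

end Summit.QuantumAdvantage.QuantumAdvantage.Theorems.HiddenSpreadWitness.Split
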